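import Summits.QuantumFields.YangMills.Theses.SqueezedSkewness
import HarnessLib

/-!
# Route `SqueezedSkewness` (rev 20, LINE χ₂ «femto currency», planner ym-idea-6 g12), glue `FemtoCurrencyGlue` (stmt-QuantumFields-23681) — BY NAME

`FemtoTwoPointUnit → CollarBumpFloors → FemtoFloorUnit`: take the unit `(r, a)` of `FemtoTwoPointUnit` (the spine's `FBL6 ∧ FC2` at a unit with
`a → 0`), apply `CollarBumpFloors` at that unit for the femto window floors of bumps of every radius, and repackage as `FemtoFloorUnit`
(the planner's kernel-checked term `FemtoCurrencyBirth.FemtoFloorUnit'_of`, restated against the route decls).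

Width seat ym-line-sfw-p2-w2 g23 (cell ym-idea-1; free hands).  HONEST FRAMING: `FemtoTwoPointUnit` (crux XL, = the spine's femto two-point package)
and `CollarBumpFloors` (support L) are OPEN; R2a RECORD-rung plumbing; no crux, NT statement, rung or summit is proved; the Yang–Mills mass gap is
NOT proved.
-/

set_option autoImplicit false

namespace Summit.QuantumFields.YangMills.Theorems

/-- **`SqueezedSkewness.FemtoCurrencyGlue`** (item stmt-QuantumFields-23681) BY NAME: `FemtoTwoPointUnit → CollarBumpFloors → FemtoFloorUnit`
(pick the unit of the first, feed its `FBL6 ∧ FC2` to the second, repackage). [folklore] -/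
theorem squeezedSkewness_femtoCurrencyGlue_proof :
    Summit.QuantumFields.YangMills.Theses.SqueezedSkewness.FemtoCurrencyGlue := by
  intro h1 h2 G _ _ _ _ hG
  obtain ⟨r, a, ha, ha0, hF, hC⟩ := h1 G hG
  exact ⟨r, a, ha, ha0, hF, h2 G hG r a ha ha0 hF hC⟩

end Summit.QuantumFields.YangMills.Theorems
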